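import Summits.Schanuel.Schanuel.Theorems.ZilberEacDriftLeader
import HarnessLib

/-!
# THEOREM L″, II: decaying power coordinate, fixed escape direction, LOG-DRIFTING transversal

Zilber's Exponential-Algebraic Closedness, case ladder (host summit Schanuel, cell `pub-schanuel`,
seat 2, gen 11).  See `ZilberEacDriftLeader` for the setting.  Along families
`x_m = r_m + y_m q`, `r_m - τ_m d → ρ₀`, `τ_m → +∞`, `‖y_m‖/τ_m^k → +∞`, with power coordinate
`w_m ≠ 0`, `‖y_m‖^N ‖w_m‖ ≤ 1` (all `N`): write `H = Σ_c G_c(X) W^c`; the TRAILING coefficient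
`G_{c*}` (lowest power of `W`) satisfies `‖G_{c*}(x_m)‖ ≥ γ > 0` eventually by the drift leader
(`exists_leader_of_drift`, for `ρ₀` off the zero set of a fixed nonzero polynomial), while every
higher power contributes `≤ poly(‖y_m‖) ‖w_m‖ · ‖w_m‖^{c*} = o(‖w_m‖^{c*})`.

* THEOREM L″ `eq_zero_of_drifting_transversal`: such families for a Zariski-dense set of `ρ₀` on
  which `H` vanishes force `H = 0` — only the plain density of the limits `ρ₀` is needed;
* density form `unprojectedDense_of_drifting_transversal` (via THEOREM H⁽ᵏ⁾).

Use: `ZilberEacInvariantDirectionDrift` (invariant bases, degrees NOT proportional to the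
invariant direction, decaying transversal drift).

HONEST FRAMING: an elimination lemma; `EC(3,2)` OPEN; nothing here bears on Schanuel's conjecture
(EAC ⇏ SC).
-/

noncomputable section

open MvPolynomial Filter Topology Finset Complex
open Literature.NumberTheory.Transcendental Literature.ModelTheory.Zilber

set_option linter.dupNamespace false

namespace Summit.Schanuel.Schanuel.Theorems

/-! ## Part A. THEOREM L″ -/

section Drift

variable {t : ℕ}

/-- **THEOREM L″ (all families).**  Fix directions `d, q ∈ ℂ^t` and a set `U ⊆ ℂ^t` on which no
nonzero polynomial vanishes identically.  Suppose that for every `ρ₀ ∈ U` there are sequences with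
`w_m ≠ 0`, `τ_m → +∞`, `r_m - τ_m d → ρ₀`, `‖y_m‖/τ_m^k → +∞` (all `k`), `‖y_m‖^N ‖w_m‖ ≤ 1` (all `N`,
eventually) and `H(w_m, r_m + y_m q) = 0` for all large `m`.  Then `H = 0`. (new) -/
theorem eq_zero_of_drifting_transversal (H : MvPolynomial (Fin (t + 1)) ℂ) (d q : Fin t → ℂ)
    {U : Set (Fin t → ℂ)} (hU : ∀ G : MvPolynomial (Fin t) ℂ, G ≠ 0 → ∃ ρ ∈ U, eval ρ G ≠ 0)
    (hseq : ∀ ρ ∈ U, ∃ (w : ℕ → ℂ) (r : ℕ → Fin t → ℂ) (τ : ℕ → ℝ) (y : ℕ → ℂ),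
      (∀ᶠ m in atTop, w m ≠ 0) ∧ Tendsto τ atTop atTop ∧
      Tendsto (fun m => r m - ((τ m : ℝ) : ℂ) • d) atTop (𝓝 ρ) ∧
      (∀ k : ℕ, Tendsto (fun m => ‖y m‖ / τ m ^ k) atTop atTop) ∧
      (∀ N : ℕ, ∀ᶠ m in atTop, ‖y m‖ ^ N * ‖w m‖ ≤ 1) ∧
      ∀ᶠ m in atTop, eval (Fin.cons (w m) (r m + y m • q) : Fin (t + 1) → ℂ) H = 0) : H = 0 := by
  classical
  by_contra hH
  set P := finSuccEquiv ℂ t H with hPdef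
  have hP0 : P ≠ 0 := fun h => hH ((finSuccEquiv ℂ t).injective (by rw [← hPdef, h, map_zero]))
  set cs : ℕ := P.natTrailingDegree with hcs
  have hG0 : P.trailingCoeff ≠ 0 := Polynomial.trailingCoeff_nonzero_iff_nonzero.2 hP0
  obtain ⟨gl, hgl0, hgl⟩ := exists_leader_of_drift P.trailingCoeff hG0 d q
  obtain ⟨ρ₀, hρ₀U, hρ₀⟩ := hU gl hgl0
  obtain ⟨w, r, τ, y, hw0, hτ, hρ, hy, hdec, hzero⟩ := hseq ρ₀ hρ₀U
  obtain ⟨γ, hγ, hlead⟩ := hgl ρ₀ hρ₀ r τ y hτ hρ hy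
  -- polynomial upper bounds for all `W`-coefficients along the family
  set D : ℕ := P.natDegree + 1 with hD
  have hcoef : ∀ c, ∃ C : ℝ, 0 ≤ C ∧ ∃ N : ℕ, ∀ x : Fin t → ℂ, ‖eval x (P.coeff c)‖ ≤ C * (1 + ‖x‖) ^ N :=
    fun c => HypersurfaceCover.exists_norm_eval_le_pow (P.coeff c)
  choose C hC0 N hCN using hcoef
  set Cm : ℝ := ∑ c ∈ range D, C c with hCm
  set Nm : ℕ := ∑ c ∈ range D, N c with hNm
  have hCc : ∀ c ∈ range D, C c ≤ Cm := fun c hc =>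
    Finset.single_le_sum (f := C) (fun c _ => hC0 c) hc
  have hNc : ∀ c ∈ range D, N c ≤ Nm := fun c hc =>
    Finset.single_le_sum (f := N) (fun c _ => Nat.zero_le _) hc
  have hCm0 : 0 ≤ Cm := Finset.sum_nonneg fun c _ => hC0 c
  -- size of `x_m`: `1 + ‖x_m‖ ≤ K ‖y_m‖` eventually
  set K : ℝ := ‖ρ₀‖ + 2 + ‖d‖ + ‖q‖ with hK
  have hK1 : 1 ≤ K := by have := norm_nonneg ρ₀; have := norm_nonneg d; have := norm_nonneg q; linarith
  have hτ1 : ∀ᶠ m in atTop, (1 : ℝ) ≤ τ m := hτ.eventually_ge_atTop 1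
  have hy1 : ∀ᶠ m in atTop, (1 : ℝ) ≤ ‖y m‖ := by
    filter_upwards [(hy 0).eventually_ge_atTop 1] with m hm; simpa using hm
  have hτy : ∀ᶠ m in atTop, τ m ≤ ‖y m‖ := by
    filter_upwards [(hy 1).eventually_ge_atTop 1, hτ1] with m hm hτm
    rw [pow_one, le_div_iff₀ (by linarith)] at hm; linarith
  have hρb : ∀ᶠ m in atTop, ‖r m - ((τ m : ℝ) : ℂ) • d‖ ≤ ‖ρ₀‖ + 1 := by
    have h := hρ
    rw [tendsto_iff_norm_sub_tendsto_zero] at h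
    filter_upwards [h.eventually (gt_mem_nhds zero_lt_one)] with m hm
    have := norm_le_norm_add_norm_sub' (r m - ((τ m : ℝ) : ℂ) • d) ρ₀
    linarith [hm.le]
  have hxK : ∀ᶠ m in atTop, 1 + ‖r m + y m • q‖ ≤ K * ‖y m‖ := by
    filter_upwards [hρb, hτy, hy1, hτ1] with m hm hτm hym hτ1m
    have e : r m + y m • q = (r m - ((τ m : ℝ) : ℂ) • d) + ((τ m : ℝ) : ℂ) • d + y m • q := by abel
    have h1 : ‖r m + y m • q‖ ≤ (‖ρ₀‖ + 1) + τ m * ‖d‖ + ‖y m‖ * ‖q‖ := by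
      rw [e]
      refine (norm_add_le _ _).trans (add_le_add ((norm_add_le _ _).trans (add_le_add hm ?_)) ?_)
      · rw [norm_smul, Complex.norm_real, Real.norm_eq_abs, abs_of_pos (by linarith)]
      · rw [norm_smul]
    have hd0 := norm_nonneg d
    have hq0 := norm_nonneg q
    have h2 : τ m * ‖d‖ ≤ ‖y m‖ * ‖d‖ := mul_le_mul_of_nonneg_right hτm hd0
    have h3 : (‖ρ₀‖ + 2) * 1 ≤ (‖ρ₀‖ + 2) * ‖y m‖ :=
      mul_le_mul_of_nonneg_left hym (by positivity)
    rw [hK]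
    nlinarith [h1, h2, h3]
  -- ### the dominance
  have hsmall : ∀ᶠ m in atTop, D * (Cm * (K * ‖y m‖) ^ Nm) * ‖w m‖ < γ := by
    -- `‖y‖^{Nm} ‖w‖ ≤ 1/‖y‖ → 0`
    have h1 : ∀ᶠ m in atTop, ‖y m‖ ^ Nm * ‖w m‖ ≤ 1 / ‖y m‖ := by
      filter_upwards [hdec (Nm + 1), hy1] with m hm hym
      rw [le_div_iff₀ (by linarith), mul_comm, ← mul_assoc, ← pow_succ']
      exact hm
    have h2 : ∀ᶠ m in atTop, D * Cm * K ^ Nm / ‖y m‖ < γ := by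
      have hlim : Tendsto (fun m => D * Cm * K ^ Nm / ‖y m‖) atTop (𝓝 0) := by
        have hy' : Tendsto (fun m => ‖y m‖) atTop atTop := by
          have := hy 0; simpa using this
        exact tendsto_const_nhds.div_atTop hy'
      exact hlim.eventually (gt_mem_nhds hγ)
    filter_upwards [h1, h2, hy1] with m hm1 hm2 hym
    have hpos : 0 ≤ (D : ℝ) * Cm * K ^ Nm := by positivity
    calc (D : ℝ) * (Cm * (K * ‖y m‖) ^ Nm) * ‖w m‖ = D * Cm * K ^ Nm * (‖y m‖ ^ Nm * ‖w m‖) := by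
          rw [mul_pow]; ring
      _ ≤ D * Cm * K ^ Nm * (1 / ‖y m‖) := mul_le_mul_of_nonneg_left hm1 hpos
      _ = D * Cm * K ^ Nm / ‖y m‖ := by ring
      _ < γ := hm2
  have hw1 : ∀ᶠ m in atTop, ‖w m‖ ≤ 1 := by
    filter_upwards [hdec 0] with m hm; simpa using hm
  have hev := hlead.and (hxK.and (hsmall.and (hw1.and (hw0.and (hzero.and hy1)))))
  obtain ⟨m, hlm, hxm, hsm, hw1m, hw0m, hzm, hym⟩ := hev.exists
  apply hw0m
  -- expand `H(w, x) = Σ_c G_c(x) w^c`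
  set x := r m + y m • q with hx
  have hdegD : (P.map (eval x)).natDegree < D :=
    (Polynomial.natDegree_map_le).trans_lt (by rw [hD]; exact Nat.lt_succ_self _)
  have hexp : eval (Fin.cons (w m) x : Fin (t + 1) → ℂ) H =
      ∑ c ∈ range D, eval x (P.coeff c) * w m ^ c := by
    rw [eval_eq_eval_mv_eval', ← hPdef, Polynomial.eval_eq_sum_range' hdegD]
    simp only [Polynomial.coeff_map]
  rw [hexp] at hzm
  have hcsD : cs ∈ range D := Finset.mem_range.2 (by
    rw [hcs, hD]; exact Nat.lt_succ_of_le (Polynomial.natTrailingDegree_le_natDegree P))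
  rw [← Finset.add_sum_erase _ _ hcsD] at hzm
  -- bound every other term by `Cm (K‖y‖)^{Nm} ‖w‖ · ‖w‖^{cs}`
  have hterm : ∀ c ∈ (range D).erase cs,
      ‖eval x (P.coeff c) * w m ^ c‖ ≤ Cm * (K * ‖y m‖) ^ Nm * ‖w m‖ * ‖w m‖ ^ cs := by
    intro c hc
    obtain ⟨hne, hcD⟩ := Finset.mem_erase.1 hc
    rcases lt_or_gt_of_ne hne with hlt | hgt
    · -- below the trailing degree the coefficient vanishes
      rw [Polynomial.coeff_eq_zero_of_lt_natTrailingDegree hlt, map_zero, zero_mul, norm_zero]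
      positivity
    · have h1 : ‖eval x (P.coeff c)‖ ≤ Cm * (K * ‖y m‖) ^ Nm := by
        refine (hCN c x).trans ?_
        have hb : (1 + ‖x‖) ^ N c ≤ (K * ‖y m‖) ^ Nm := by
          calc (1 + ‖x‖) ^ N c ≤ (K * ‖y m‖) ^ N c := pow_le_pow_left₀ (by positivity) hxm _
            _ ≤ (K * ‖y m‖) ^ Nm := pow_le_pow_right₀ (by nlinarith) (hNc c hcD)
        exact mul_le_mul (hCc c hcD) hb (by positivity) hCm0
      have h2 : ‖w m‖ ^ c ≤ ‖w m‖ * ‖w m‖ ^ cs := by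
        have : ‖w m‖ ^ c ≤ ‖w m‖ ^ (cs + 1) :=
          pow_le_pow_of_le_one (norm_nonneg _) hw1m (by omega)
        rw [pow_succ'] at this
        exact this
      rw [norm_mul, norm_pow]
      exact mul_le_mul h1 h2 (by positivity) (by positivity) |>.trans (le_of_eq (by ring))
  have hrest : ‖∑ c ∈ (range D).erase cs, eval x (P.coeff c) * w m ^ c‖ ≤
      D * (Cm * (K * ‖y m‖) ^ Nm) * ‖w m‖ * ‖w m‖ ^ cs := by
    refine (norm_sum_le _ _).trans ((Finset.sum_le_sum hterm).trans ?_)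
    rw [Finset.sum_const]
    have hcard : (((range D).erase cs).card : ℝ) ≤ D := by
      have := Finset.card_erase_le (s := range D) (a := cs)
      rw [Finset.card_range] at this
      exact_mod_cast this
    rw [nsmul_eq_mul]
    have : 0 ≤ Cm * (K * ‖y m‖) ^ Nm * ‖w m‖ * ‖w m‖ ^ cs := by positivity
    nlinarith
  -- the trailing term dominates
  have hmain : γ * ‖w m‖ ^ cs ≤ ‖eval x (P.coeff cs) * w m ^ cs‖ := by
    rw [norm_mul, norm_pow]
    exact mul_le_mul_of_nonneg_right hlm (by positivity)
  by_contra hwne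
  have hwpos : 0 < ‖w m‖ ^ cs := pow_pos (norm_pos_iff.2 hwne) _
  have h := norm_add_le (eval x (P.coeff cs) * w m ^ cs) (∑ c ∈ (range D).erase cs, eval x (P.coeff c) * w m ^ c)
  have hsum0 : eval x (P.coeff cs) * w m ^ cs = -∑ c ∈ (range D).erase cs, eval x (P.coeff c) * w m ^ c := by
    linear_combination hzm
  rw [hsum0, norm_neg] at hmain
  nlinarith [hmain, hrest, hsm, hwpos]

end Drift

/-! ## Part B. Density form -/

section Density

variable {n t : ℕ}

/-- **THEOREM L″ (density from drifting transversals with a decaying power coordinate).**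
`S ⊆ ℂⁿ × ℂⁿ` irreducible closed of dimension `≤ t + 1`, coordinates `c` and `β`, directions `d, q`,
and a set `U ⊆ ℂ^t` supporting no nonzero polynomial.  If for every `ρ₀ ∈ U` there are exponential
points `p_m ∈ S` (large `m`) whose `c`-coordinates are `r_m + y_m q` with `r_m - τ_m d → ρ₀`,
`τ_m → +∞`, `‖y_m‖/τ_m^k → +∞`, and whose `β`-coordinate `w_m ≠ 0` satisfies `‖y_m‖^N ‖w_m‖ ≤ 1`
eventually for every `N`, then `I(S ∩ Γ_exp) = I(S)`. (new) -/
theorem unprojectedDense_of_drifting_transversal {S : Set (Fin n ⊕ Fin n → ℂ)}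
    (hS : IsIrreducibleClosed ℂ S) (hdim : zariskiDim ℂ S ≤ ((t + 1 : ℕ) : WithBot ℕ∞))
    (c : Fin t → Fin n ⊕ Fin n) (β : Fin n ⊕ Fin n) (d q : Fin t → ℂ)
    {U : Set (Fin t → ℂ)} (hU : ∀ G : MvPolynomial (Fin t) ℂ, G ≠ 0 → ∃ ρ ∈ U, eval ρ G ≠ 0)
    (hpts : ∀ ρ ∈ U, ∃ (p : ℕ → Fin n ⊕ Fin n → ℂ) (r : ℕ → Fin t → ℂ) (τ : ℕ → ℝ) (y : ℕ → ℂ),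
      (∀ᶠ m : ℕ in atTop, p m ∈ S ∧ p m ∈ expGraph ℂ n) ∧
      (∀ᶠ m : ℕ in atTop, (fun i => p m (c i)) = r m + y m • q) ∧
      (∀ᶠ m : ℕ in atTop, p m β ≠ 0) ∧ Tendsto τ atTop atTop ∧
      Tendsto (fun m => r m - ((τ m : ℝ) : ℂ) • d) atTop (𝓝 ρ) ∧
      (∀ k : ℕ, Tendsto (fun m => ‖y m‖ / τ m ^ k) atTop atTop) ∧
      (∀ N : ℕ, ∀ᶠ m : ℕ in atTop, ‖y m‖ ^ N * ‖p m β‖ ≤ 1)) :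
    UnprojectedDense S := by
  refine unprojectedDense_of_no_relation hS hdim (Fin.cons β c) fun H hH0 => ?_
  by_contra hcon
  push Not at hcon
  apply hH0
  refine eq_zero_of_drifting_transversal H d q hU fun ρ hρ => ?_
  obtain ⟨p, r, τ, y, hpS, hcoord, hβ, hτ, hr, hy, hdec⟩ := hpts ρ hρ
  refine ⟨fun m => p m β, r, τ, y, hβ, hτ, hr, hy, hdec, ?_⟩
  filter_upwards [hpS, hcoord] with m hm hmc
  rw [← hmc, ← comp_fin_cons]
  exact hcon (p m) hm

end Density

end Summit.Schanuel.Schanuel.Theorems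

end
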